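import Summits.Ventures.DiscreteObjects.PP12.FlagExterior

/-!
# PP(12): the flag cell `|G| = 3` as the conjunction of its four typed sub-cells `f = 1, 4, 7, 10`
Framing: lottery ticket; floor = certified bounds/negative ranges.

Cell pub-namedobj (venture DiscreteObjects), target (M), designs gen 11. `LiveCellsOrder3.NoFlagOrder3Order12` (designs g9) is the
typed census statement of the live `|G| = 3` cell of a putative projective plane of order 12 (flag-type collineations of order 3,
`1, 4, 7` or `10` fixed points and as many fixed lines). This file TYPES the four sub-cells `NoFlagOrder3Order12Fixed f`
(exactly `f` fixed points; NOT proved — each is 'beyond bound k' in NAMEDOBJ-TABLE §M) and proves `flag_subcells`: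
`NoFlagOrder3Order12 ↔ NoFlag…Fixed 1 ∧ NoFlag…Fixed 4 ∧ NoFlag…Fixed 7 ∧ NoFlag…Fixed 10` (the fixed-line count is redundant by
Baer's equality `fixedCard_points_eq_lines`). With `FlagExterior.card_exterior_flag_order12` the sub-cell `f` has exactly
`12 · (13 − f)` exterior points. No `sorry`, no new axioms; the only new definition is the typed sub-cell statement.
-/

namespace Summit.Ventures.DiscreteObjects.PP12

open Configuration Finset
open scoped Classical

/-- **Census statement, flag sub-cell with exactly `f` fixed points (typed, NOT proved):** no projective plane of order 12 admits a
collineation `σ ≠ 1` with `σ³ = 1` of flag type (all fixed points on a fixed line `l`, all fixed lines through a fixed point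
`c ∈ l`) with exactly `f` fixed points. The census cell `NoFlagOrder3Order12` is the conjunction over `f ∈ {1, 4, 7, 10}`
(`flag_subcells`). -/
def NoFlagOrder3Order12Fixed (f : ℕ) : Prop :=
  ∀ (P L : Type) [Membership P L] [Fintype P] [Fintype L] [ProjectivePlane P L],
    ProjectivePlane.order P L = 12 → ∀ σ : Collineation P L, σ.onPoints ^ 3 = 1 → σ.onPoints ≠ 1 →
      ¬ (∃ (l : L) (c : P), σ.onLines l = l ∧ σ.onPoints c = c ∧ c ∈ l ∧
          (∀ p : P, σ.onPoints p = p → p ∈ l) ∧ (∀ m : L, σ.onLines m = m → c ∈ m) ∧ fixedCard σ.onPoints = f)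

/-- **The flag cell is the conjunction of its four sub-cells `f = 1, 4, 7, 10`** (Baer's equality `f = g` makes the line count
redundant). -/
theorem flag_subcells :
    NoFlagOrder3Order12 ↔ (NoFlagOrder3Order12Fixed 1 ∧ NoFlagOrder3Order12Fixed 4 ∧ NoFlagOrder3Order12Fixed 7 ∧
      NoFlagOrder3Order12Fixed 10) := by
  constructor
  · intro h
    have key : ∀ f : ℕ, (f = 1 ∨ f = 4 ∨ f = 7 ∨ f = 10) → NoFlagOrder3Order12Fixed f := by
      intro f hf P L _ _ _ _ h12 σ hq hne ⟨l, c, hl, hc, hcl, hP, hL, hfix⟩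
      refine h P L h12 σ hq hne ⟨l, c, hl, hc, hcl, hP, hL, ?_, ?_⟩
      · rw [hfix]; exact hf
      · rw [← σ.fixedCard_points_eq_lines, hfix]; exact hf
    exact ⟨key 1 (by norm_num), key 4 (by norm_num), key 7 (by norm_num), key 10 (by norm_num)⟩
  · rintro ⟨h1, h4, h7, h10⟩ P L _ _ _ _ h12 σ hq hne ⟨l, c, hl, hc, hcl, hP, hL, hf, -⟩
    rcases hf with hf | hf | hf | hf
    · exact h1 P L h12 σ hq hne ⟨l, c, hl, hc, hcl, hP, hL, hf⟩
    · exact h4 P L h12 σ hq hne ⟨l, c, hl, hc, hcl, hP, hL, hf⟩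
    · exact h7 P L h12 σ hq hne ⟨l, c, hl, hc, hcl, hP, hL, hf⟩
    · exact h10 P L h12 σ hq hne ⟨l, c, hl, hc, hcl, hP, hL, hf⟩

open Literature.Combinatorics.Designs Summit.Ventures.DiscreteObjects.STD in
/-- **Rigid endgame, v5 (sub-cell form).** Janko–van Trung's `{2,3}`-group theorem (named fact), the finite array statements
`NoLiftableSTD2_12_6` (involution cell) and `NoLiftableSTD3_12_4` (order-3 elation cell), and the FOUR typed flag sub-cells `f = 1, 4, 7, 10`
force every collineation group of a projective plane of order 12 to be trivial. (v4 = `card_collineationGroup_eq_one_v4` with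
`NoFlagOrder3Order12` split by `flag_subcells`; the planar cell is the theorem `noPlanarOrder3Order12`, Roth 1964. Census status 2026-08-22:
all four sub-cell hypotheses OPEN — 'typed / undecided'; for `f = 10` the ORBIT LEVEL is decided empty by computation outside the kernel,
designs g11 FAMILY-FLAG10, one seat.) -/
theorem card_collineationGroup_eq_one_v5 (hJvT : CollineationGroupIsTwoThreeGroup)
    (h2 : NoLiftableSTD2_12_6) (h3E : NoLiftableSTD3_12_4)
    (hF1 : NoFlagOrder3Order12Fixed 1) (hF4 : NoFlagOrder3Order12Fixed 4) (hF7 : NoFlagOrder3Order12Fixed 7)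
    (hF10 : NoFlagOrder3Order12Fixed 10)
    (P L : Type) [Membership P L] [Fintype P] [Fintype L] [ProjectivePlane P L] (h12 : ProjectivePlane.order P L = 12)
    (G : Type) [Group G] [Fintype G] [MulAction G P] [MulAction G L] (hG : IsCollineationGroup G P L) :
    Fintype.card G = 1 :=
  card_collineationGroup_eq_one_v4 hJvT h2 h3E (flag_subcells.mpr ⟨hF1, hF4, hF7, hF10⟩) P L h12 G hG

end Summit.Ventures.DiscreteObjects.PP12
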